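import Summits.QuantumFields.BalabanUV.Beta.FP.CoarseJetOrderTwoGraded
import Summits.QuantumFields.BalabanUV.Beta.FP.RelInvPeriodisedCombRecord
import Summits.QuantumFields.BalabanUV.Beta.FP.RelInvPeriodisedCombMinOp

/-!
# `BalabanUV.Beta.FP.CoarseJetOrderTwoGradedComb` — road «FP» (binder row D1), ROUTE T, presentation T-β, option (δ) «LIFT ∕ GRADED» (R-FP-54′), the (J-a) dictionary's item
# **(γ-sym)** at ORDER 2: **THE GRADED COARSE SECOND JET OF THE TORUS CALL AND THE `hId₂` SANDWICH, FOR THE CHART-(III′) TABLES** — leaf-05 g28's `CoarseJetOrderTwoGraded` §2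
# re-read at `𝕄′_j = bhKStepSh d Lc (Dsh Lc) j`, `Â′ = perF M (GcombSh Lc j)` (both the live-masked `Θ ∕ Θᴸ` AND the `μμ` block `Ŝ` are read off `Â′` — (E) for chart (III′))

HONEST DEPENDENCY (page 1, mandatory): continuum YM on T⁴ ⇐ BetaPertH ∧ nine spine estimates (0/9 proved); BetaPertH ⇐ (D1) ∧ (D4) ∧
CAP+tail; G-an2-4 gates asym, D1 and NE2/3/4.  HONEST FRAMING (cell contract, verbatim): «discharging `BetaPertH` makes Bałaban's UV
stability UNCONDITIONAL — a real constructive-QFT result; it is NOT the continuum limit and NOT the Clay problem.»  ABSOLUTE RULE (cell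
charter, verbatim): «No internally-minted statement may enter as a cited fact. Every hypothesis is either kernel-proved in this package or a
verbatim quotation of a PUBLISHED theorem with page reference. The manuscript(s) under audit are NOT citable for their own disputed steps — they
are the thing under adjudication; programme-internal (2001/route/tribunal) claims are never citable.»

CONTENT = `CoarseJetOrderTwoGraded` §2 with the rooted record theorems replaced by their chart-(III′) twins (`RelInvPeriodisedCombMinOp.torus_minOp(L)_submatrix_inl_comb`,
`torus_flucCov_eq_comb`, `RelInvPeriodisedCombRecord.effForm_toBlocks₁₁_comb`), the generic §1 (`orderTwo_word_toBlocks₁₁_graded`) reused BY NAME; root `ρ_c = ctr (d+1) Lc`, `τ₁ := combRowsT (ctr (d+1) Lc) Lc M`: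
`torus_orderTwo_word_toBlocks₁₁_graded_comb`, `torus_hId₂_iff_graded_comb` — every `d`, `Lc ≥ 1`, EVERY level `j`, every box with `Lc ∣ M_i`.
[folklore] short readings; nothing of an1's ∕ an2's ∕ leaf-02's ∕ leaf-03's restated; no `Prop`, no `def`, nothing cited, 0 sorry; discharges NO binder of row D1; NOT the dictionary's
`hId₂` (it makes its left side explicit at the sym tables), NOT (J-a), NOT (T-ID), NOT SDF, NOT D1, NOT BetaPertH, NOT continuum, NOT Clay; 0 estimates.
Unit `b2b-balaban-beta-d1-formalise-leaf-05` (gen 29), 2026-08-22; no existing file touched.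
-/

noncomputable section

open scoped BigOperators Matrix

namespace Summit.QuantumFields.BalabanUV.Beta.FP.CoarseJetOrderTwoGradedComb

open Matrix
open Literature.Probability.LatticeModels (Torus.proj)
open Literature.MathematicalPhysics.QuantumFieldTheory.Balaban1983to89
open Literature.MathematicalPhysics.QuantumFieldTheory.Balaban1983to89.Beta
open Literature.MathematicalPhysics.QuantumFieldTheory.Balaban1983to89.Beta.Composition (kkt)
open Literature.MathematicalPhysics.QuantumFieldTheory.Balaban1983to89.Beta.CompositionSingular (effForm flucCov minOp minOpL minOpL_eq_transpose)
open B6Lemma24Torus (pbox)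
open AffineAveraging (Site box toSite)
open AveragingContoursRooted (ctr ctrOff)
open OneStepResolventKernel (Fib)
open Summit.QuantumFields.BalabanUV.Beta.AxialDressingRooted (axEc)
open Summit.QuantumFields.BalabanUV.Beta.SymShiftedSpread (bhKStepSh)
open Summit.QuantumFields.BalabanUV.Beta.DshAn1 (Dsh)
open Summit.QuantumFields.BalabanUV.Beta.CombChartStepJets (GcombSh)
open Summit.QuantumFields.BalabanUV.Beta.FP.KernelPeriodisationFib (Idx perF)
open Summit.QuantumFields.BalabanUV.Beta.FP.TorusCombRows (Res combRowsT)
open Summit.QuantumFields.BalabanUV.Beta.FP.RelInvPeriodisedCombRecord (effForm_toBlocks₁₁_comb)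
open Summit.QuantumFields.BalabanUV.Beta.FP.RelInvPeriodisedCombMinOp (torus_minOp_submatrix_inl_comb torus_minOpL_submatrix_inl_comb torus_flucCov_eq_comb)
open Summit.QuantumFields.BalabanUV.Beta.FP.CoarseJetOrderTwoGraded (orderTwo_word_toBlocks₁₁_graded)

/-! ## §2 At the chart-(III′) record: the coarse second jet in closed form -/

section Record

variable {d : ℕ} {Lc : ℕ} [NeZero Lc] (M : Fin (d + 1) → ℕ) [∀ μ, NeZero (M μ)]

set_option synthInstance.maxSize 1024 in
/-- **[folklore] THE COARSE SECOND JET OF THE TORUS CALL IN CLOSED FORM.**  On any box `M` with `Lc ∣ Mᵢ`, root `ρ_c = ctr (d+1) Lc`, at the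
presentation of record (`hH₀ hQ₁₀ hτ₁`; coarse multipliers by any injective `inr`-valued `fμ` with `hcoarse`; p308750's namings `hΓ hI hL hS hB`), with the
four TORUS BLOCKS NAMED: `hΘ : Θ = of (fun (s,α) a ↦ axEc s s (inl α) (inl α) · Â (s, inl α) (fμ a))` (minimiser), `hΘL : Θᴸ = of (fun a (s,α) ↦ axEc · Â (fμ a) (s, inl α))`
(left companion, up to sign), `hŜ : Ŝ = (perF M (GcombSh Lc j))∘(fμ,fμ)` (effective form), `hΓc : Γ̂ = of (fun b b' ↦ axEc b · (axEc b' · Â b b'))`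
(fluctuation covariance), `Â := perF M (GcombSh Lc j)`: for ANY jets `H₁ H₂ Q₁₁ Q₁₂`, the `μμ` block of the GRADED order-2 word equals
the §1 polynomial with `L_{μ·} := −Θᴸ`, `I_{·μ} := Θ`, `S₁₁ := Ŝ`, `Γ := Γ̂`. -/
theorem torus_orderTwo_word_toBlocks₁₁_graded_comb (hM : ∀ i, Lc ∣ M i) (j : ℕ)
    {μ : Type*} [Fintype μ] [DecidableEq μ] (fμ : μ → Idx M (Fib d)) (hfμ : Function.Injective fμ)
    (hμ : ∀ a : μ, ∃ m : Fin (d + 1), (fμ a).2 = Sum.inr m)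
    (hcoarse : ∀ (s : ↥(pbox M)) (m : Fin (d + 1)), ((s, Sum.inr m) : Idx M (Fib d)) ∈ Set.range fμ ↔ Torus.proj Lc (s : Site (d + 1)) = 0)
    {H₀ : Matrix (↥(pbox M) × Fin (d + 1)) (↥(pbox M) × Fin (d + 1)) ℝ} {Q₁₀ : Matrix μ (↥(pbox M) × Fin (d + 1)) ℝ}
    {τ₁ : Matrix (Res (ctr (d + 1) Lc) Lc M) (↥(pbox M) × Fin (d + 1)) ℝ}
    (hH₀ : H₀ = (perF M (bhKStepSh d Lc (Dsh Lc) j)).submatrix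
        (fun b : ↥(pbox M) × Fin (d + 1) => ((b.1, Sum.inl b.2) : Idx M (Fib d))) (fun b : ↥(pbox M) × Fin (d + 1) => ((b.1, Sum.inl b.2) : Idx M (Fib d))))
    (hQ₁₀ : Q₁₀ = (perF M (bhKStepSh d Lc (Dsh Lc) j)).submatrix fμ (fun b : ↥(pbox M) × Fin (d + 1) => ((b.1, Sum.inl b.2) : Idx M (Fib d))))
    (hτ₁ : τ₁ = (combRowsT (ctr (d + 1) Lc) Lc M).submatrix id (fun b : ↥(pbox M) × Fin (d + 1) => ((b.1, Sum.inl b.2) : Idx M (Fib d))))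
    {Γ : Matrix (↥(pbox M) × Fin (d + 1)) (↥(pbox M) × Fin (d + 1)) ℝ}
    {I : Matrix (↥(pbox M) × Fin (d + 1)) (μ ⊕ Res (ctr (d + 1) Lc) Lc M) ℝ} {L : Matrix (μ ⊕ Res (ctr (d + 1) Lc) Lc M) (↥(pbox M) × Fin (d + 1)) ℝ}
    {S : Matrix (μ ⊕ Res (ctr (d + 1) Lc) Lc M) (μ ⊕ Res (ctr (d + 1) Lc) Lc M) ℝ} {B : Matrix (μ ⊕ Res (ctr (d + 1) Lc) Lc M) (↥(pbox M) × Fin (d + 1)) ℝ}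
    (hΓ : flucCov H₀ (fromRows Q₁₀ τ₁) = Γ) (hI : minOp H₀ (fromRows Q₁₀ τ₁) = I) (hL : minOpL H₀ (fromRows Q₁₀ τ₁) = L)
    (hS : effForm H₀ (fromRows Q₁₀ τ₁) = S)
    (H₁ H₂ : Matrix (↥(pbox M) × Fin (d + 1)) (↥(pbox M) × Fin (d + 1)) ℝ) (Q₁₁ Q₁₂ : Matrix μ (↥(pbox M) × Fin (d + 1)) ℝ)
    (hB : fromRows Q₁₁ (0 : Matrix (Res (ctr (d + 1) Lc) Lc M) (↥(pbox M) × Fin (d + 1)) ℝ) = B)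
    -- the four torus blocks, NAMED
    {Θ : Matrix (↥(pbox M) × Fin (d + 1)) μ ℝ} {ΘL : Matrix μ (↥(pbox M) × Fin (d + 1)) ℝ} {Ŝ : Matrix μ μ ℝ}
    {Γc : Matrix (↥(pbox M) × Fin (d + 1)) (↥(pbox M) × Fin (d + 1)) ℝ}
    (hΘ : Θ = Matrix.of fun (b : ↥(pbox M) × Fin (d + 1)) (a : μ) =>
        axEc (ctr (d + 1) Lc) Lc (b.1 : Site (d + 1)) (b.1 : Site (d + 1)) (Sum.inl b.2) (Sum.inl b.2)
          * perF M (GcombSh (d := d) Lc j) (b.1, Sum.inl b.2) (fμ a))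
    (hΘL : ΘL = Matrix.of fun (a : μ) (b : ↥(pbox M) × Fin (d + 1)) =>
        axEc (ctr (d + 1) Lc) Lc (b.1 : Site (d + 1)) (b.1 : Site (d + 1)) (Sum.inl b.2) (Sum.inl b.2)
          * perF M (GcombSh (d := d) Lc j) (fμ a) (b.1, Sum.inl b.2))
    (hŜ : Ŝ = (perF M (GcombSh (d := d) Lc j)).submatrix fμ fμ)
    (hΓc : Γc = Matrix.of fun (b b' : ↥(pbox M) × Fin (d + 1)) =>
        axEc (ctr (d + 1) Lc) Lc (b.1 : Site (d + 1)) (b.1 : Site (d + 1)) (Sum.inl b.2) (Sum.inl b.2)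
          * (axEc (ctr (d + 1) Lc) Lc (b'.1 : Site (d + 1)) (b'.1 : Site (d + 1)) (Sum.inl b'.2) (Sum.inl b'.2)
            * perF M (GcombSh (d := d) Lc j) (b.1, Sum.inl b.2) (b'.1, Sum.inl b'.2))) :
    (((-((L * H₁ - S * B) * Γ - L * Bᵀ * L) * H₁ + L * H₂
          - (((L * H₁ - S * B) * I + L * Bᵀ * S) * B + S * fromRows Q₁₂ (0 : Matrix (Res (ctr (d + 1) Lc) Lc M) (↥(pbox M) × Fin (d + 1)) ℝ))) * I
        + (L * H₁ - S * B) * (-((Γ * H₁ + I * B) * I + Γ * Bᵀ * S)))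
      - ((-((L * H₁ - S * B) * Γ - L * Bᵀ * L) * (-Bᵀ) + L * (fromRows Q₁₂ (0 : Matrix (Res (ctr (d + 1) Lc) Lc M) (↥(pbox M) × Fin (d + 1)) ℝ))ᵀ) * S
          + L * (-Bᵀ) * ((L * H₁ - S * B) * I + L * Bᵀ * S))).toBlocks₁₁
      = (((-((-ΘL * H₁ - Ŝ * Q₁₁) * Γc - -ΘL * Q₁₁ᵀ * -ΘL) * H₁ + -ΘL * H₂
          - (((-ΘL * H₁ - Ŝ * Q₁₁) * Θ + -ΘL * Q₁₁ᵀ * Ŝ) * Q₁₁ + Ŝ * Q₁₂)) * Θ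
        + (-ΘL * H₁ - Ŝ * Q₁₁) * (-((Γc * H₁ + Θ * Q₁₁) * Θ + Γc * Q₁₁ᵀ * Ŝ)))
      - ((-((-ΘL * H₁ - Ŝ * Q₁₁) * Γc - -ΘL * Q₁₁ᵀ * -ΘL) * (-Q₁₁ᵀ) + -ΘL * Q₁₂ᵀ) * Ŝ
          + -ΘL * (-Q₁₁ᵀ) * ((-ΘL * H₁ - Ŝ * Q₁₁) * Θ + -ΘL * Q₁₁ᵀ * Ŝ))) := by
  rw [orderTwo_word_toBlocks₁₁_graded H₁ H₂ Q₁₁ Q₁₂ Γ I L S hB, ← hΓ, ← hI, ← hL, ← hS, hH₀, hQ₁₀, hτ₁,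
    torus_minOp_submatrix_inl_comb M hM j fμ hfμ hμ hcoarse, torus_minOpL_submatrix_inl_comb M hM j fμ hfμ hμ hcoarse,
    effForm_toBlocks₁₁_comb M hM j fμ hfμ hμ hcoarse, torus_flucCov_eq_comb M hM j fμ hfμ hμ hcoarse, hΘ, hΘL, hŜ, hΓc]

set_option synthInstance.maxSize 1024 in
/-- **[folklore] THE DICTIONARY's `hId₂` IS ONE POLYNOMIAL IDENTITY IN THE FOUR TORUS BLOCKS.**  In the setting of `torus_orderTwo_word_toBlocks₁₁_graded`,
for any scalar `c` and any candidate level-`(j+1)` second insertion table `H'₂`: `hId₂ : (GRADED order-2 word).toBlocks₁₁ = c • H'₂ ↔ (§2's polynomial) = c • H'₂`. -/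
theorem torus_hId₂_iff_graded_comb (hM : ∀ i, Lc ∣ M i) (j : ℕ)
    {μ : Type*} [Fintype μ] [DecidableEq μ] (fμ : μ → Idx M (Fib d)) (hfμ : Function.Injective fμ)
    (hμ : ∀ a : μ, ∃ m : Fin (d + 1), (fμ a).2 = Sum.inr m)
    (hcoarse : ∀ (s : ↥(pbox M)) (m : Fin (d + 1)), ((s, Sum.inr m) : Idx M (Fib d)) ∈ Set.range fμ ↔ Torus.proj Lc (s : Site (d + 1)) = 0)
    {H₀ : Matrix (↥(pbox M) × Fin (d + 1)) (↥(pbox M) × Fin (d + 1)) ℝ} {Q₁₀ : Matrix μ (↥(pbox M) × Fin (d + 1)) ℝ}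
    {τ₁ : Matrix (Res (ctr (d + 1) Lc) Lc M) (↥(pbox M) × Fin (d + 1)) ℝ}
    (hH₀ : H₀ = (perF M (bhKStepSh d Lc (Dsh Lc) j)).submatrix
        (fun b : ↥(pbox M) × Fin (d + 1) => ((b.1, Sum.inl b.2) : Idx M (Fib d))) (fun b : ↥(pbox M) × Fin (d + 1) => ((b.1, Sum.inl b.2) : Idx M (Fib d))))
    (hQ₁₀ : Q₁₀ = (perF M (bhKStepSh d Lc (Dsh Lc) j)).submatrix fμ (fun b : ↥(pbox M) × Fin (d + 1) => ((b.1, Sum.inl b.2) : Idx M (Fib d))))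
    (hτ₁ : τ₁ = (combRowsT (ctr (d + 1) Lc) Lc M).submatrix id (fun b : ↥(pbox M) × Fin (d + 1) => ((b.1, Sum.inl b.2) : Idx M (Fib d))))
    {Γ : Matrix (↥(pbox M) × Fin (d + 1)) (↥(pbox M) × Fin (d + 1)) ℝ}
    {I : Matrix (↥(pbox M) × Fin (d + 1)) (μ ⊕ Res (ctr (d + 1) Lc) Lc M) ℝ} {L : Matrix (μ ⊕ Res (ctr (d + 1) Lc) Lc M) (↥(pbox M) × Fin (d + 1)) ℝ}
    {S : Matrix (μ ⊕ Res (ctr (d + 1) Lc) Lc M) (μ ⊕ Res (ctr (d + 1) Lc) Lc M) ℝ} {B : Matrix (μ ⊕ Res (ctr (d + 1) Lc) Lc M) (↥(pbox M) × Fin (d + 1)) ℝ}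
    (hΓ : flucCov H₀ (fromRows Q₁₀ τ₁) = Γ) (hI : minOp H₀ (fromRows Q₁₀ τ₁) = I) (hL : minOpL H₀ (fromRows Q₁₀ τ₁) = L)
    (hS : effForm H₀ (fromRows Q₁₀ τ₁) = S)
    (H₁ H₂ : Matrix (↥(pbox M) × Fin (d + 1)) (↥(pbox M) × Fin (d + 1)) ℝ) (Q₁₁ Q₁₂ : Matrix μ (↥(pbox M) × Fin (d + 1)) ℝ)
    (hB : fromRows Q₁₁ (0 : Matrix (Res (ctr (d + 1) Lc) Lc M) (↥(pbox M) × Fin (d + 1)) ℝ) = B)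
    {Θ : Matrix (↥(pbox M) × Fin (d + 1)) μ ℝ} {ΘL : Matrix μ (↥(pbox M) × Fin (d + 1)) ℝ} {Ŝ : Matrix μ μ ℝ}
    {Γc : Matrix (↥(pbox M) × Fin (d + 1)) (↥(pbox M) × Fin (d + 1)) ℝ}
    (hΘ : Θ = Matrix.of fun (b : ↥(pbox M) × Fin (d + 1)) (a : μ) =>
        axEc (ctr (d + 1) Lc) Lc (b.1 : Site (d + 1)) (b.1 : Site (d + 1)) (Sum.inl b.2) (Sum.inl b.2)
          * perF M (GcombSh (d := d) Lc j) (b.1, Sum.inl b.2) (fμ a))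
    (hΘL : ΘL = Matrix.of fun (a : μ) (b : ↥(pbox M) × Fin (d + 1)) =>
        axEc (ctr (d + 1) Lc) Lc (b.1 : Site (d + 1)) (b.1 : Site (d + 1)) (Sum.inl b.2) (Sum.inl b.2)
          * perF M (GcombSh (d := d) Lc j) (fμ a) (b.1, Sum.inl b.2))
    (hŜ : Ŝ = (perF M (GcombSh (d := d) Lc j)).submatrix fμ fμ)
    (hΓc : Γc = Matrix.of fun (b b' : ↥(pbox M) × Fin (d + 1)) =>
        axEc (ctr (d + 1) Lc) Lc (b.1 : Site (d + 1)) (b.1 : Site (d + 1)) (Sum.inl b.2) (Sum.inl b.2)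
          * (axEc (ctr (d + 1) Lc) Lc (b'.1 : Site (d + 1)) (b'.1 : Site (d + 1)) (Sum.inl b'.2) (Sum.inl b'.2)
            * perF M (GcombSh (d := d) Lc j) (b.1, Sum.inl b.2) (b'.1, Sum.inl b'.2)))
    (c : ℝ) (H'₂ : Matrix μ μ ℝ) :
    (((-((L * H₁ - S * B) * Γ - L * Bᵀ * L) * H₁ + L * H₂
          - (((L * H₁ - S * B) * I + L * Bᵀ * S) * B + S * fromRows Q₁₂ (0 : Matrix (Res (ctr (d + 1) Lc) Lc M) (↥(pbox M) × Fin (d + 1)) ℝ))) * I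
        + (L * H₁ - S * B) * (-((Γ * H₁ + I * B) * I + Γ * Bᵀ * S)))
      - ((-((L * H₁ - S * B) * Γ - L * Bᵀ * L) * (-Bᵀ) + L * (fromRows Q₁₂ (0 : Matrix (Res (ctr (d + 1) Lc) Lc M) (↥(pbox M) × Fin (d + 1)) ℝ))ᵀ) * S
          + L * (-Bᵀ) * ((L * H₁ - S * B) * I + L * Bᵀ * S))).toBlocks₁₁ = c • H'₂ ↔
      (((-((-ΘL * H₁ - Ŝ * Q₁₁) * Γc - -ΘL * Q₁₁ᵀ * -ΘL) * H₁ + -ΘL * H₂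
          - (((-ΘL * H₁ - Ŝ * Q₁₁) * Θ + -ΘL * Q₁₁ᵀ * Ŝ) * Q₁₁ + Ŝ * Q₁₂)) * Θ
        + (-ΘL * H₁ - Ŝ * Q₁₁) * (-((Γc * H₁ + Θ * Q₁₁) * Θ + Γc * Q₁₁ᵀ * Ŝ)))
      - ((-((-ΘL * H₁ - Ŝ * Q₁₁) * Γc - -ΘL * Q₁₁ᵀ * -ΘL) * (-Q₁₁ᵀ) + -ΘL * Q₁₂ᵀ) * Ŝ
          + -ΘL * (-Q₁₁ᵀ) * ((-ΘL * H₁ - Ŝ * Q₁₁) * Θ + -ΘL * Q₁₁ᵀ * Ŝ))) = c • H'₂ := by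
  rw [torus_orderTwo_word_toBlocks₁₁_graded_comb M hM j fμ hfμ hμ hcoarse hH₀ hQ₁₀ hτ₁ hΓ hI hL hS H₁ H₂ Q₁₁ Q₁₂ hB hΘ hΘL hŜ hΓc]

end Record

end Summit.QuantumFields.BalabanUV.Beta.FP.CoarseJetOrderTwoGradedComb

end
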